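import Summits.QuantumFields.YangMills.Theorems.BalabanUVNodesN18StepMatchedLetterRecord

/-!
# BalabanUVNodes ∕ N18 — THE STEP-MATCHED N18 LETTER, PRODUCER SIDE: what node N18's analytic estimate must prove under R-N18-SEL — a `K`-eventual η-rate between the FINITE-VOLUME
# (1.20) kernels of the two runs AT THE STEP-MATCHED BOX HISTORIES ONLY (`1∕(w 0)² = 1∕(w 1)² + β₁(w 0)`), + the (1.21) existence ⟹ the kernel step-matched letter (limits), hence —
# under K3's reading pin — `ShiftAlongRun` for the datum's β and the N19′ `h18` (FILE 2 BY NAME); today's box windowed letter `WindowedStepRate(OfRecord₁₃)` is STRONGER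
# (Track A, DAG node N18 = NE5; key K3⁸ `SpineGivenEndpointR13SepCoPHV` = stmt-QuantumFields-27366, skeleton v6 b4e55110ab73e679; width seat `pub-ymgap-dag-n18-w1` g7, FILE 4 — producer edition of
# FILES 1–2; pattern of g2's `…N18KernelStepRateBoxes` §2b ∕ §4 (p594018 ∕ p595852) and `…N18AtRecordOfKernelLetters.kernelStepRate_of_windowed` (p597580))

HONEST FRAMING.  Count-neutral kernel bookkeeping BY NAME (`--kind proof --supports stmt-QuantumFields-27366 --as helper`): g2's `abs_polLimit_sub_polLimit_le_of_eventually` (`le_of_tendsto`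
along `K → ∞`) at the step-matched histories, def-W1's `kernelA_eq` ∕ `histPrefix_prependCoupling` bookkeeping, FILE 2's pin theorems.  The WINDOWED STEP-MATCHED RATE (finite volume) and
the (1.21) existence are DISPLAYED HYPOTHESES on Bałaban's merged term — the CONTENT of node N18 under the re-keying, NOT PRINTED for d = 4 ([Balaban1987RG1] Thm 1 p. 259 has only
the uniformity in ε) and NOT supplied; nothing of Bałaban's is asserted, inhabited, discharged or refuted; N17 ∕ N18 NOT discharged; K3⁸ OPEN (v6), no stub proved ∕ refuted, NO
skeleton re-keyed; K3⁷ 20544 aside.  Counts UNMOVED (typed 28∕28 · discharged 5∕27, A 5∕28).  One finite four-torus programme at fixed `ε`, Bałaban AS PRINTED; route R4 closes ONLY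
the conditional finite-𝕋⁴ rung `BalabanLadder.UV` — NOT the continuum limit, NOT ℝ⁴, NOT OS, NOT the Yang–Mills mass gap, NOT Clay.  THEOREMS ONLY: 0 `def`, 0 `instance`, 0 `sorry`,
standard axioms.

WHAT (theorems only).  §9 generic `ℰ`: `cons_histPrefix_mem_box` · ★★ `kernelStepMatched_of_windowedStepMatched` ((1.21) existence on the boxes + the WINDOWED STEP-MATCHED RATE — for every box
history `w ∈ ]0,γ]^{k+2}` WITH `1∕(w 0)² = 1∕(w 1)² + β 0 (w 0)`, run B's windowed kernel (approximation `K+s`, level `k+2`, history `w`) and run A's (approximation `K`, level `k+1`,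
history `tail w`) are `K`-eventually `C₅θ·θ^k·e^{−κ|x|₁}`-close — ⟹ the kernel step-matched letter `γ κ θ C₅` for `β`) · `windowedStepMatched_of_windowedStepRate` (W1-19b's box
windowed letter ⟹ it, any β).  §10 at the record ∕ under the pin: ★★ `kernelStepMatchedOfRecord_of_windowedStepMatchedOfRecord` (the merged term family of record, window-form (1.21)
letter) · ★★ `shiftAlongRun_of_readOutAt_pin_windowedStepMatched` ((D4) at the pinned bundle + the finite-volume letter of record ⟹ `ShiftAlongRun (ℓ.cr·ℓ.C₅·ℓ.θ₅·ℓ.θ₅^·) D.βfun g^B K`,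
FILE 2 §5 BY NAME) · `ne5_selector_of_windowedStepMatched_pin` (the N19′ `h18` at the pinned bundle from the finite-volume letter + a recovering selector).

References (TYPES ∕ locators only): [Balaban1987RG1] CMP **109** (1987): (0.18)–(0.20) pp. 255–256, Thm 1 p. 259, (1.20)–(1.22) p. 264, (1.6) p. 261, §5 p. 298.
-/

noncomputable section

namespace YMDAG.N18.StepMatchedLetter

open Literature.MathematicalPhysics.QuantumFieldTheory.Balaban1983to89
open Literature.MathematicalPhysics.QuantumFieldTheory.Balaban1983to89.T4Continuum (T4Family ULoop)
open Literature.MathematicalPhysics.QuantumFieldTheory.Balaban1983to89.FlowStep (Box HBeta mem_box RGEqH)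
open Literature.MathematicalPhysics.QuantumFieldTheory.Balaban1983to89.T4OutputRate (Window NE5 mem_window)
open Literature.MathematicalPhysics.QuantumFieldTheory.Balaban1983to89.T4FlagMemory (tail_mem_box)
open Literature.MathematicalPhysics.QuantumFieldTheory.Balaban1983to89.Node00 (TermFamily1 prependCoupling U3Letters₁₁ Stage13Params Stage13HParams)
open Literature.MathematicalPhysics.QuantumFieldTheory.Balaban1983to89.Node00.U3OfKernels (kernelA EA EB pt carriers objects objectsOfRecord₁₃ histPrefix histPrefix_apply
  histPrefix_prependCoupling kernelA_eq)
open Literature.MathematicalPhysics.QuantumFieldTheory.Balaban1983to89.Node00.U3KernelLetters (WindowedStepRate WindowedStepRateOfRecord₁₃)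
open Literature.MathematicalPhysics.QuantumFieldTheory.Balaban1983to89.B12Sec2to5 (l1)
open Summit.QuantumFields.BalabanUV.T4Continuum.NE7MarginalL1Currency (ShiftAlongRun)
open YMDAG.N18.KernelStepRateBoxes (abs_polLimit_sub_polLimit_le_of_eventually)
open YMDAG.UVSplit

/-! ## §9 Generic term family: the WINDOWED STEP-MATCHED RATE (finite volume) + (1.21) existence ⟹ the kernel step-matched letter

THE WINDOWED STEP-MATCHED RATE at `(ℰ, β, γ, s, κ, θ, C′)` (spelled inline): for every box history `w ∈ ]0,γ]^{k+2}` whose first two entries are a (0.20)-step of `β`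
(`1∕(w 0)² = 1∕(Fin.tail w 0)² + β 0 (w 0)`), at every `(μ, ν, x)`, EVENTUALLY in the approximation index `K`:
`|polWindow (K+s) (k+2) (ℰ (k+1) w (K+s)) − polWindow K (k+1) (ℰ k (tail w) K)| ≤ C′·θ^k·e^{−κ|x|₁}` — W1-19b's `WindowedStepRate` asked ONLY at the step-matched histories. -/

section Kernels

open scoped Matrix.Norms.L2Operator

variable {𝔄 : Type*} [NormedRing 𝔄] [NormedAlgebra ℝ 𝔄]
variable {V : Type*} [NormedAddCommGroup V] [NormedSpace ℝ V] {ι : Type*} [Fintype ι]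
variable (F : T4Family) (ℰ : TermFamily1 F 𝔄) (ρ : V →L[ℝ] 𝔄) (bV : Module.Basis ι ℝ V)

/-- Bookkeeping: the box history `(b, g_0, …, g_k)` of a first coupling `b ∈ ]0,γ]` prepended to the prefix of a window sequence `g ∈ ]0,γ]^ℕ` lies in the box `]0,γ]^{k+2}`.
[cite: Balaban1987RG1, Thm 1 p.259 (bookkeeping)] -/
theorem cons_histPrefix_mem_box {γ b : ℝ} (hb : 0 < b) (hbγ : b ≤ γ) {g : ℕ → ℝ} (hg : g ∈ Window γ) (k : ℕ) :
    (Fin.cons b (histPrefix g k) : Fin (k + 2) → ℝ) ∈ Box γ (k + 1) := by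
  refine mem_box.mpr fun i => ?_
  refine Fin.cases ?_ (fun j => ?_) i
  · simpa using And.intro hb hbγ
  · simpa using (mem_window.mp hg) j

/-- ★★ **THE KERNEL STEP-MATCHED LETTER FROM FINITE VOLUME**: the (1.21) limits of the term family exist on the boxes (`hex`, box form of W1-19b's `PolLimitsExist`) and the WINDOWED
STEP-MATCHED RATE holds with constant `C₅θ` (`hfin`) ⟹ for every first coupling `b ∈ ]0,γ]` and every `g ∈ ]0,γ]^ℕ` with `1∕b² = 1∕(g 0)² + β 0 (b)`:
`|Π_{k+1}(g; z) − Π_{k+2}(b, g; z)| ≤ C₅θ^{k+1}e^{−κ|z|₁}` (limits of eventually-close windows are close, g2's `abs_polLimit_sub_polLimit_le_of_eventually`; the matched history is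
`w = (b, g_0, …, g_k)`, `kernelA_eq` ∕ `histPrefix_prependCoupling`).  So under R-N18-SEL node N18's CONTENT is: the finite-volume two-run η-rate AT THE STEP-MATCHED HISTORIES — where the two
runs are Bałaban's actual pair (ε∕L-run from `b`, ε-run from its first RG image). [cite: Balaban1987RG1, (1.20)–(1.21) p.264 and Thm 1 p.259] -/
theorem kernelStepMatched_of_windowedStepMatched {β : HBeta} {γ κ θ C₅ : ℝ} (s : ℕ)
    (hex : ∀ (k : ℕ) (v : Fin (k + 1) → ℝ), v ∈ Box γ k → Node00.PolLimitExists F (k + 1) (fun K => ℰ k v K) ρ bV)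
    (hfin : ∀ (k : ℕ) (w : Fin (k + 2) → ℝ), w ∈ Box γ (k + 1) → 1 / (w 0) ^ 2 = 1 / (Fin.tail w 0) ^ 2 + β 0 (fun _ => w 0) →
      ∀ (μ ν : Fin 4) (x : Fin 4 → ℤ), ∀ᶠ K in Filter.atTop,
        |Node00.polWindow F (K + s) (k + 1 + 1) (ℰ (k + 1) w (K + s)) ρ bV μ ν x - Node00.polWindow F K (k + 1) (ℰ k (Fin.tail w) K) ρ bV μ ν x| ≤
          C₅ * θ * θ ^ k * Real.exp (-κ * l1 x)) :
    ∀ b, 0 < b → b ≤ γ → ∀ g ∈ Window γ, 1 / b ^ 2 = 1 / (g 0) ^ 2 + β 0 (fun _ => b) → ∀ (k : ℕ) (μ ν : Fin 4) (z : Fin 4 → ℤ),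
      |kernelA F ℰ ρ bV g k μ ν z - kernelA F ℰ ρ bV (prependCoupling b g) (k + 1) μ ν z| ≤ C₅ * θ ^ (k + 1) * Real.exp (-(κ * l1 z)) := by
  intro b hb hbγ g hg hm k μ ν z
  set w : Fin (k + 2) → ℝ := Fin.cons b (histPrefix g k) with hw_def
  have hw : w ∈ Box γ (k + 1) := cons_histPrefix_mem_box hb hbγ hg k
  have hw0 : w 0 = b := by simp [hw_def]
  have htail : Fin.tail w = histPrefix g k := by simp [hw_def]
  have hm' : 1 / (w 0) ^ 2 = 1 / (Fin.tail w 0) ^ 2 + β 0 (fun _ => w 0) := by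
    rw [hw0, htail, histPrefix_apply]; exact hm
  have h := abs_polLimit_sub_polLimit_le_of_eventually F ρ bV (fun K => ℰ (k + 1) w K) (fun K => ℰ k (Fin.tail w) K)
    (hex (k + 1) w hw) (hex k (Fin.tail w) (tail_mem_box hw)) μ ν z s (hfin k w hw hm' μ ν z)
  have hA : kernelA F ℰ ρ bV g k = Node00.polLimit F (k + 1) (fun K => ℰ k (Fin.tail w) K) ρ bV := by rw [kernelA_eq, htail]
  have hB : kernelA F ℰ ρ bV (prependCoupling b g) (k + 1) = Node00.polLimit F (k + 1 + 1) (fun K => ℰ (k + 1) w K) ρ bV := by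
    rw [kernelA_eq, histPrefix_prependCoupling]
  rw [hA, hB, abs_sub_comm]
  have e : C₅ * θ * θ ^ k * Real.exp (-κ * l1 z) = C₅ * θ ^ (k + 1) * Real.exp (-(κ * l1 z)) := by rw [pow_succ, neg_mul]; ring
  rw [← e]
  exact h

/-- W1-19b's BOX windowed letter `WindowedStepRate F ℰ ρ bV γ s κ θ C′` (every box history, free first coupling) implies the windowed step-matched rate for EVERY β (drop the matching
condition) — today's producer target is STRONGER than R-N18-SEL's. [cite: Balaban1987RG1, Thm 1 p.259 and (1.20)–(1.21) p.264] -/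
theorem windowedStepMatched_of_windowedStepRate {γ κ θ C' : ℝ} {s : ℕ} (h : WindowedStepRate F ℰ ρ bV γ s κ θ C') (β : HBeta) :
    ∀ (k : ℕ) (w : Fin (k + 2) → ℝ), w ∈ Box γ (k + 1) → 1 / (w 0) ^ 2 = 1 / (Fin.tail w 0) ^ 2 + β 0 (fun _ => w 0) →
      ∀ (μ ν : Fin 4) (x : Fin 4 → ℤ), ∀ᶠ K in Filter.atTop,
        |Node00.polWindow F (K + s) (k + 1 + 1) (ℰ (k + 1) w (K + s)) ρ bV μ ν x - Node00.polWindow F K (k + 1) (ℰ k (Fin.tail w) K) ρ bV μ ν x| ≤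
          C' * θ ^ k * Real.exp (-κ * l1 x) :=
  fun k w hw _ μ ν x => h k w hw μ ν x

end Kernels

/-! ## §10 At the record (the merged term family of record, W1-19) and under K3's reading pin: finite volume ⟹ the kernel letter of record ⟹ FILE 2's consumers -/

section Record

open scoped Matrix.Norms.L2Operator

variable (F : T4Family) {N : ℕ} [NeZero N]

/-- ★★ **THE KERNEL STEP-MATCHED LETTER OF RECORD FROM FINITE VOLUME**: the window-form (1.21) existence letter for the merged term family of record (the definers' `PolLimitsExist …
(Window θ.γ)` shape, unfolded) and the WINDOWED STEP-MATCHED RATE OF RECORD with constant `ℓ.C₅·ℓ.θ₅` (Bałaban's (2.13)-terms of the two runs on the same tori at the step-matched box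
histories of `β`, `K`-eventually) ⟹ FILE 2's kernel step-matched letter of record `θ.γ ℓ.κ ℓ.θ₅ ℓ.C₅` for `β` (stated through `(objectsOfRecord₁₃ …).EA 0`).  Both inputs are node
N18's CONTENT under the re-keying — NOT supplied. [cite: Balaban1987RG1, (1.20)–(1.21) p.264, (1.6) p.261 and Thm 1 p.259] -/
theorem kernelStepMatchedOfRecord_of_windowedStepMatchedOfRecord (θ : Stage13Params F N) (ℓ : U3Letters₁₁) (β : HBeta) (s : ℕ)
    (hex : letI := θ.instVβ₁; letI := θ.instVβ₂; letI := θ.instιβ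
      ∀ g ∈ Window θ.γ, ∀ k : ℕ, Node00.PolLimitExists F (k + 1)
        (fun K => Node00.mergedTermFamilyMatT F N (Node00.TβOfRecord₁₃ F N) (Node00.chiβOfRecord₁₃ F N θ) θ.εbg k (histPrefix g k) K) θ.ρ8 θ.bV)
    (hfin : letI := θ.instVβ₁; letI := θ.instVβ₂; letI := θ.instιβ
      ∀ (k : ℕ) (w : Fin (k + 2) → ℝ), w ∈ Box θ.γ (k + 1) → 1 / (w 0) ^ 2 = 1 / (Fin.tail w 0) ^ 2 + β 0 (fun _ => w 0) →
        ∀ (μ ν : Fin 4) (x : Fin 4 → ℤ), ∀ᶠ K in Filter.atTop,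
        |Node00.polWindow F (K + s) (k + 1 + 1)
            (Node00.mergedTermFamilyMatT F N (Node00.TβOfRecord₁₃ F N) (Node00.chiβOfRecord₁₃ F N θ) θ.εbg (k + 1) w (K + s)) θ.ρ8 θ.bV μ ν x -
          Node00.polWindow F K (k + 1)
            (Node00.mergedTermFamilyMatT F N (Node00.TβOfRecord₁₃ F N) (Node00.chiβOfRecord₁₃ F N θ) θ.εbg k (Fin.tail w) K) θ.ρ8 θ.bV μ ν x| ≤
          ℓ.C₅ * ℓ.θ₅ * ℓ.θ₅ ^ k * Real.exp (-ℓ.κ * l1 x)) :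
    ∀ b, 0 < b → b ≤ θ.γ → ∀ g ∈ Window θ.γ, 1 / b ^ 2 = 1 / (g 0) ^ 2 + β 0 (fun _ => b) → ∀ (k : ℕ) (μ ν : Fin 4) (z : Fin 4 → ℤ),
      |(objectsOfRecord₁₃ F N θ ℓ).EA 0 g PUnit.unit (pt k μ ν z) - (objectsOfRecord₁₃ F N θ ℓ).EA 0 (prependCoupling b g) PUnit.unit (pt (k + 1) μ ν z)| ≤
        ℓ.C₅ * ℓ.θ₅ ^ (k + 1) * Real.exp (-(ℓ.κ * l1 z)) := by
  letI := θ.instVβ₁; letI := θ.instVβ₂; letI := θ.instιβ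
  have h := kernelStepMatched_of_windowedStepMatched F
    (Node00.mergedTermFamilyMatT F N (Node00.TβOfRecord₁₃ F N) (Node00.chiβOfRecord₁₃ F N θ) θ.εbg) θ.ρ8 θ.bV (β := β) s
    (YMDAG.N18.KernelStepRateBoxes.polLimitExists_box_of_window F _ θ.ρ8 θ.bV hex) hfin
  exact fun b hb hbγ g hg hm k μ ν z => h b hb hbγ g hg hm k μ ν z

/-- ★★ **UNDER THE PIN: (D4) AT THE PINNED BUNDLE + THE FINITE-VOLUME STEP-MATCHED LETTER OF RECORD ⟹ NE4 ALONG THE PREFIXES OF THE DATUM's RUNS** (FILE 2 §5 BY NAME): with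
`hpin : (𝔯.lit …).u3 = objectsOfRecord₁₃ …`, `ReadOutAt D (rateCarriersOfRecord₁₃CoPH 𝔯 F θ hP g₀ os k).u3`, the window-form (1.21) letter and the windowed step-matched rate of record for
`D.βfun` ⟹ `ShiftAlongRun (ℓ.cr·ℓ.C₅·ℓ.θ₅·ℓ.θ₅^·) D.βfun g^B K` for every `g^B` in `]0,θ.γ]` up to `K+1` obeying (0.20) at its first step — the `hU2` road's input (FILE 1 ∕ 3), with NO
box conjunct and the producer target stated in FINITE volume. [cite: Balaban1987RG1, (0.20) p.256, (1.20)–(1.22) p.264, Thm 1 p.259] -/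
theorem shiftAlongRun_of_readOutAt_pin_windowedStepMatched (𝔯 : RateReading₁₃CoPH N) (θ : Stage13HParams F N) (hP : θ.Provisos₁₃CoPH F N)
    (g₀ : ℕ → ℝ) (os : List (ULoop F)) (ℓ : U3Letters₁₁) (hpin : (𝔯.lit F θ hP g₀ os).u3 = objectsOfRecord₁₃ F N θ.toStage13Params ℓ) (kk s : ℕ) (D : Datum F N)
    (hD4 : ReadOutAt D (rateCarriersOfRecord₁₃CoPH 𝔯 F θ hP g₀ os kk).u3)
    (hex : letI := θ.instVβ₁; letI := θ.instVβ₂; letI := θ.instιβ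
      ∀ g ∈ Window θ.γ, ∀ k : ℕ, Node00.PolLimitExists F (k + 1)
        (fun K => Node00.mergedTermFamilyMatT F N (Node00.TβOfRecord₁₃ F N) (Node00.chiβOfRecord₁₃ F N θ.toStage13Params) θ.εbg k (histPrefix g k) K) θ.ρ8 θ.bV)
    (hfin : letI := θ.instVβ₁; letI := θ.instVβ₂; letI := θ.instιβ
      ∀ (k : ℕ) (w : Fin (k + 2) → ℝ), w ∈ Box θ.γ (k + 1) → 1 / (w 0) ^ 2 = 1 / (Fin.tail w 0) ^ 2 + D.βfun 0 (fun _ => w 0) →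
        ∀ (μ ν : Fin 4) (x : Fin 4 → ℤ), ∀ᶠ K in Filter.atTop,
        |Node00.polWindow F (K + s) (k + 1 + 1)
            (Node00.mergedTermFamilyMatT F N (Node00.TβOfRecord₁₃ F N) (Node00.chiβOfRecord₁₃ F N θ.toStage13Params) θ.εbg (k + 1) w (K + s)) θ.ρ8 θ.bV μ ν x -
          Node00.polWindow F K (k + 1)
            (Node00.mergedTermFamilyMatT F N (Node00.TβOfRecord₁₃ F N) (Node00.chiβOfRecord₁₃ F N θ.toStage13Params) θ.εbg k (Fin.tail w) K) θ.ρ8 θ.bV μ ν x| ≤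
          ℓ.C₅ * ℓ.θ₅ * ℓ.θ₅ ^ k * Real.exp (-ℓ.κ * l1 x))
    {K : ℕ} {gB : ℕ → ℝ} (hstep0 : 1 / (gB 0) ^ 2 = 1 / (gB 1) ^ 2 + D.βfun 0 (fun _ => gB 0)) (hbox : ∀ i, i ≤ K + 1 → 0 < gB i ∧ gB i ≤ θ.γ) :
    ShiftAlongRun (fun j => ℓ.cr * ℓ.C₅ * ℓ.θ₅ * ℓ.θ₅ ^ j) D.βfun gB K :=
  shiftAlongRun_of_readOutAt_pin_kernelStepMatched F 𝔯 θ hP g₀ os ℓ hpin kk D hD4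
    (kernelStepMatchedOfRecord_of_windowedStepMatchedOfRecord F θ.toStage13Params ℓ D.βfun s hex hfin) hstep0 hbox

/-- **… AND THE N19′ RATE EDGE's `h18` AT THE PINNED BUNDLE FROM FINITE VOLUME** (FILE 2 `ne5_selector_of_kernelStepMatched_pin` BY NAME): the finite-volume step-matched letter of record
for `β` + a recovering selector on `]0,θ.γ]^ℕ` ⟹ `NE5 R.u3.EA (fun s ↦ R.u3.EB (bsel s) s) R.u3.W …` at `R := rateCarriersOfRecord₁₃CoPH 𝔯 F θ hP g₀ os k`.
[cite: Balaban1987RG1, (1.20)–(1.21) p.264, Thm 1 p.259, (0.20) p.256] -/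
theorem ne5_selector_of_windowedStepMatched_pin (𝔯 : RateReading₁₃CoPH N) (θ : Stage13HParams F N) (hP : θ.Provisos₁₃CoPH F N) (g₀ : ℕ → ℝ) (os : List (ULoop F))
    (ℓ : U3Letters₁₁) (hpin : (𝔯.lit F θ hP g₀ os).u3 = objectsOfRecord₁₃ F N θ.toStage13Params ℓ) (kk s : ℕ) (β : HBeta)
    (hex : letI := θ.instVβ₁; letI := θ.instVβ₂; letI := θ.instιβ
      ∀ g ∈ Window θ.γ, ∀ k : ℕ, Node00.PolLimitExists F (k + 1)
        (fun K => Node00.mergedTermFamilyMatT F N (Node00.TβOfRecord₁₃ F N) (Node00.chiβOfRecord₁₃ F N θ.toStage13Params) θ.εbg k (histPrefix g k) K) θ.ρ8 θ.bV)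
    (hfin : letI := θ.instVβ₁; letI := θ.instVβ₂; letI := θ.instιβ
      ∀ (k : ℕ) (w : Fin (k + 2) → ℝ), w ∈ Box θ.γ (k + 1) → 1 / (w 0) ^ 2 = 1 / (Fin.tail w 0) ^ 2 + β 0 (fun _ => w 0) →
        ∀ (μ ν : Fin 4) (x : Fin 4 → ℤ), ∀ᶠ K in Filter.atTop,
        |Node00.polWindow F (K + s) (k + 1 + 1)
            (Node00.mergedTermFamilyMatT F N (Node00.TβOfRecord₁₃ F N) (Node00.chiβOfRecord₁₃ F N θ.toStage13Params) θ.εbg (k + 1) w (K + s)) θ.ρ8 θ.bV μ ν x -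
          Node00.polWindow F K (k + 1)
            (Node00.mergedTermFamilyMatT F N (Node00.TβOfRecord₁₃ F N) (Node00.chiβOfRecord₁₃ F N θ.toStage13Params) θ.εbg k (Fin.tail w) K) θ.ρ8 θ.bV μ ν x| ≤
          ℓ.C₅ * ℓ.θ₅ * ℓ.θ₅ ^ k * Real.exp (-ℓ.κ * l1 x))
    {bsel : (ℕ → ℝ) → ℝ} (hbsel : ∀ t ∈ Window θ.γ, 0 < bsel t ∧ bsel t ≤ θ.γ ∧ 1 / (bsel t) ^ 2 = 1 / (t 0) ^ 2 + β 0 (fun _ => bsel t)) :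
    NE5 (rateCarriersOfRecord₁₃CoPH 𝔯 F θ hP g₀ os kk).u3.EA (fun t => (rateCarriersOfRecord₁₃CoPH 𝔯 F θ hP g₀ os kk).u3.EB (bsel t) t)
      (rateCarriersOfRecord₁₃CoPH 𝔯 F θ hP g₀ os kk).u3.W (rateCarriersOfRecord₁₃CoPH 𝔯 F θ hP g₀ os kk).u3.κ (rateCarriersOfRecord₁₃CoPH 𝔯 F θ hP g₀ os kk).u3.θ
      (rateCarriersOfRecord₁₃CoPH 𝔯 F θ hP g₀ os kk).u3.C₅ :=
  ne5_selector_of_kernelStepMatched_pin F 𝔯 θ hP g₀ os ℓ hpin kk β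
    (kernelStepMatchedOfRecord_of_windowedStepMatchedOfRecord F θ.toStage13Params ℓ β s hex hfin) hbsel

end Record

end YMDAG.N18.StepMatchedLetter

end
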